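import Mathlib
import Summits.AtomisticToContinuum.Crystallization.Theses.PhononSlackCertificates
import Summits.AtomisticToContinuum.Crystallization.Theorems.PhononSlackCertificatesNearFarGlueRLooseReduction
import Summits.AtomisticToContinuum.Crystallization.Theorems.PhononSlackCertificatesNearFarGlueRNearFree
import Summits.AtomisticToContinuum.Crystallization.Theorems.PhononSlackCertificatesNearFarGlueRStructure
import Summits.AtomisticToContinuum.Crystallization.Theorems.PhononSlackCertificatesNearFarGlueRTorusOfSep
import Summits.AtomisticToContinuum.Crystallization.Theorems.PhononSlackCertificatesNearFarGlueRSepOfTorus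
import Summits.AtomisticToContinuum.Crystallization.Theorems.ChargedEnergyGap.Negative.BlocksBound
import Literature.Geometry.DiscreteGeometry.TwoShellPatterns

/-!
# Crux `PhononSlackCertificates.NearFarGlueR` (stmt-AtomisticToContinuum-14970), line `Sketch`:
the TORUS FORM of the residual — every periodic configuration pays per tight contact per cell

Continuation lead c5.  With the two wave-2 stubs `stub_torusOfSepTight` (trial blocks,
`…NearFarGlueRTorusOfSep.lean`) and `stub_sepTightOfTorus` (far periodisation,
`…NearFarGlueRSepOfTorus.lean`) and c3's `tightContactGap_iff_sep`, the registered residual of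
the line is ONE statement of the tree with its torus form

  `∃ g > 0, ∀ P : PeriodicConfiguration 3, P.points 3/10-separated →
      e* + g · #{y ∈ motif : y set-bad in P.points, some set-good z ∈ P.points within 21/20}/#motif
        ≤ e(P)`

— no `δ`, no finite-size or boundary effects: EVERY periodic Lennard-Jones configuration lies
above `e*` by `g` times its density of tight contacts (`tightContactGap_iff_torusTightContactGap`).
Consequently the crux and the target read, in torus terms,
`NearFarGlueR ↔ (FarFieldGapR → NearFieldConvexity → torus tight contact gap)`
(`nearFarGlueR_iff_torusTightContactGap`) and
`CoerciveTwoShellGap ↔ AllBadGap ∧ torus tight contact gap`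
(`coerciveTwoShellGap_iff_allBadGap_and_torusTightContactGap`).  Unfolding the infimum, the
torus form is an `e*`-FREE REPAIR statement (`torusTightContactGap_iff_repair`,
`tightContactGap_iff_repair`): one `g > 0` such that every periodic configuration with a tight
contact is beaten by SOME periodic configuration by `g` per tight contact per cell — the unknown
ground-state energy is replaced by the explicit `e(P)` of the configuration to be repaired, and a
proof of the residual is exactly a uniform repair procedure for tight contacts in periodic matter
(removal gains iff the particle's full binding exceeds `e(P)`, insertion at `p` gains iff
`W_p < e(P)`: the c3/c4 species reappear with `e(P)` in place of the two cones).  This is the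
recommended statement of the promoted crux; its explicit sufficient form — SOME periodic `Q₀`
beats every periodic configuration by `g` per tight contact per cell, no `e*`, no infimum —
is `tightContactGap_of_referenceGap`.  All `[folklore]`.
-/

noncomputable section

namespace Summit.AtomisticToContinuum.Crystallization.Theorems.PhononSlackCertificatesNearFarGlueR

open Literature.MathematicalPhysics.StatisticalMechanics
open Literature.Geometry.DiscreteGeometry
open Summit.AtomisticToContinuum.Crystallization.Theses.PhononSlackCertificates
open scoped BigOperators Classical

/-! ## §1 The torus form is an `e*`-free REPAIR statement -/

/-- **Torus form ⟺ repair form.**  One `g > 0` charges every periodic configuration with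
`3/10`-separated point set `g` per tight contact per cell above `e*` iff one `g > 0` lets every
such configuration WITH a tight contact be beaten by some periodic configuration by `g` per
tight contact per cell: `e(P') ≤ e(P) − g·#T(motif)/#motif`.  (⇒ `e* < e(P) − (g/2)·…`, unfold
the infimum; ⇐ `e* ≤ e(P')`.)  In the repair form `e*` does not occur: the unknown ground-state
energy is replaced by the explicit `e(P)` of the configuration to be repaired. [folklore] -/
theorem torusTightContactGap_iff_repair :
    (∃ g : ℝ, 0 < g ∧ ∀ P : PeriodicConfiguration 3,
      (∀ u ∈ P.points, ∀ v ∈ P.points, u ≠ v → (3 / 10 : ℝ) ≤ dist u v) →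
      (⨅ Q : PeriodicConfiguration 3, Q.energyPerParticle lennardJones)
        + g * ((P.motif.filter fun y => ¬ IsTwoShellGoodSet (1 / 20) (47 / 50) 1 P.points y ∧
            ∃ z ∈ P.points, IsTwoShellGoodSet (1 / 20) (47 / 50) 1 P.points z ∧
              dist z y ≤ 21 / 20).card : ℝ) / (P.motif.card : ℝ)
        ≤ P.energyPerParticle lennardJones) ↔
    (∃ g : ℝ, 0 < g ∧ ∀ P : PeriodicConfiguration 3,
      (∀ u ∈ P.points, ∀ v ∈ P.points, u ≠ v → (3 / 10 : ℝ) ≤ dist u v) →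
      0 < (P.motif.filter fun y => ¬ IsTwoShellGoodSet (1 / 20) (47 / 50) 1 P.points y ∧
            ∃ z ∈ P.points, IsTwoShellGoodSet (1 / 20) (47 / 50) 1 P.points z ∧
              dist z y ≤ 21 / 20).card →
      ∃ P' : PeriodicConfiguration 3, P'.energyPerParticle lennardJones ≤
        P.energyPerParticle lennardJones
          - g * ((P.motif.filter fun y => ¬ IsTwoShellGoodSet (1 / 20) (47 / 50) 1 P.points y ∧
              ∃ z ∈ P.points, IsTwoShellGoodSet (1 / 20) (47 / 50) 1 P.points z ∧
                dist z y ≤ 21 / 20).card : ℝ) / (P.motif.card : ℝ)) := by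
  have hbdd := ChargedEnergyGapNegative.bddBelow_energyPerParticle_lennardJones
  constructor
  · rintro ⟨g, hg, H⟩
    refine ⟨g / 2, by positivity, fun P hsep hT => ?_⟩
    have hP := H P hsep
    have hm : (0 : ℝ) < P.motif.card := by exact_mod_cast P.motif_nonempty.card_pos
    have hTr : (0 : ℝ) < ((P.motif.filter fun y => ¬ IsTwoShellGoodSet (1 / 20) (47 / 50) 1 P.points y ∧
        ∃ z ∈ P.points, IsTwoShellGoodSet (1 / 20) (47 / 50) 1 P.points z ∧
          dist z y ≤ 21 / 20).card : ℝ) := by exact_mod_cast hT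
    have hpos : 0 < g / 2 * ((P.motif.filter fun y => ¬ IsTwoShellGoodSet (1 / 20) (47 / 50) 1
        P.points y ∧ ∃ z ∈ P.points, IsTwoShellGoodSet (1 / 20) (47 / 50) 1 P.points z ∧
          dist z y ≤ 21 / 20).card : ℝ) / (P.motif.card : ℝ) := by positivity
    have hlt : (⨅ Q : PeriodicConfiguration 3, Q.energyPerParticle lennardJones) <
        P.energyPerParticle lennardJones - g / 2 * ((P.motif.filter fun y =>
          ¬ IsTwoShellGoodSet (1 / 20) (47 / 50) 1 P.points y ∧ ∃ z ∈ P.points,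
            IsTwoShellGoodSet (1 / 20) (47 / 50) 1 P.points z ∧ dist z y ≤ 21 / 20).card : ℝ) /
          (P.motif.card : ℝ) := by
      have : g * ((P.motif.filter fun y => ¬ IsTwoShellGoodSet (1 / 20) (47 / 50) 1 P.points y ∧
          ∃ z ∈ P.points, IsTwoShellGoodSet (1 / 20) (47 / 50) 1 P.points z ∧
            dist z y ≤ 21 / 20).card : ℝ) / (P.motif.card : ℝ) = 2 * (g / 2 * ((P.motif.filter fun y =>
          ¬ IsTwoShellGoodSet (1 / 20) (47 / 50) 1 P.points y ∧ ∃ z ∈ P.points,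
            IsTwoShellGoodSet (1 / 20) (47 / 50) 1 P.points z ∧ dist z y ≤ 21 / 20).card : ℝ) /
          (P.motif.card : ℝ)) := by ring
      linarith
    obtain ⟨P', hP'⟩ := exists_lt_of_ciInf_lt hlt
    exact ⟨P', hP'.le⟩
  · rintro ⟨g, hg, H⟩
    refine ⟨g, hg, fun P hsep => ?_⟩
    by_cases hT : 0 < (P.motif.filter fun y => ¬ IsTwoShellGoodSet (1 / 20) (47 / 50) 1 P.points y ∧
        ∃ z ∈ P.points, IsTwoShellGoodSet (1 / 20) (47 / 50) 1 P.points z ∧ dist z y ≤ 21 / 20).card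
    · obtain ⟨P', hP'⟩ := H P hsep hT
      have h1 : (⨅ Q : PeriodicConfiguration 3, Q.energyPerParticle lennardJones) ≤
          P'.energyPerParticle lennardJones := ciInf_le hbdd P'
      linarith
    · have h0 : (P.motif.filter fun y => ¬ IsTwoShellGoodSet (1 / 20) (47 / 50) 1 P.points y ∧
          ∃ z ∈ P.points, IsTwoShellGoodSet (1 / 20) (47 / 50) 1 P.points z ∧
            dist z y ≤ 21 / 20).card = 0 := by omega
      rw [h0]
      have h1 : (⨅ Q : PeriodicConfiguration 3, Q.energyPerParticle lennardJones) ≤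
          P.energyPerParticle lennardJones := ciInf_le hbdd P
      simpa using h1

/-! ## §2 The residual is its torus form -/

/-- **The residual IS its torus form**: the registered tight contact gap (`∀ δ > 0 ∃ g₂ …`) holds
iff one `g > 0` charges every periodic configuration with `3/10`-separated point set `g` per
tight contact per cell.  (⇒ `tightContactGap_iff_sep` then trial blocks `stub_torusOfSepTight`;
⇐ far periodisation `stub_sepTightOfTorus` then `tightContactGap_iff_sep`.) [folklore] -/
theorem tightContactGap_iff_torusTightContactGap :
    (∀ δ : ℝ, 0 < δ → ∃ g₂ : ℝ, 0 < g₂ ∧ ∀ (N : ℕ) (x : Fin N → EuclideanSpace ℝ (Fin 3)),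
      (∀ i j : Fin N, i ≠ j → δ ≤ dist (x i) (x j)) →
      (N : ℝ) * (⨅ Q : PeriodicConfiguration 3, Q.energyPerParticle lennardJones)
        + g₂ * (Nat.card {j : Fin N // ¬ IsTwoShellGood (1 / 20) (47 / 50) 1 x j ∧
            ∃ i : Fin N, IsTwoShellGood (1 / 20) (47 / 50) 1 x i ∧ dist (x i) (x j) ≤ 21 / 20} : ℝ)
        ≤ interactionEnergy lennardJones x) ↔
    (∃ g : ℝ, 0 < g ∧ ∀ P : PeriodicConfiguration 3,
      (∀ u ∈ P.points, ∀ v ∈ P.points, u ≠ v → (3 / 10 : ℝ) ≤ dist u v) →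
      (⨅ Q : PeriodicConfiguration 3, Q.energyPerParticle lennardJones)
        + g * ((P.motif.filter fun y => ¬ IsTwoShellGoodSet (1 / 20) (47 / 50) 1 P.points y ∧
            ∃ z ∈ P.points, IsTwoShellGoodSet (1 / 20) (47 / 50) 1 P.points z ∧
              dist z y ≤ 21 / 20).card : ℝ) / (P.motif.card : ℝ)
        ≤ P.energyPerParticle lennardJones) := by
  rw [tightContactGap_iff_sep]
  exact ⟨stub_torusOfSepTight, stub_sepTightOfTorus⟩

/-- **Registered sub-goal `stub_torusForm` of the line `Sketch`** (the same statement).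
[folklore] -/
theorem stub_torusForm :
    (∀ δ : ℝ, 0 < δ → ∃ g₂ : ℝ, 0 < g₂ ∧ ∀ (N : ℕ) (x : Fin N → EuclideanSpace ℝ (Fin 3)),
      (∀ i j : Fin N, i ≠ j → δ ≤ dist (x i) (x j)) →
      (N : ℝ) * (⨅ Q : PeriodicConfiguration 3, Q.energyPerParticle lennardJones)
        + g₂ * (Nat.card {j : Fin N // ¬ IsTwoShellGood (1 / 20) (47 / 50) 1 x j ∧
            ∃ i : Fin N, IsTwoShellGood (1 / 20) (47 / 50) 1 x i ∧ dist (x i) (x j) ≤ 21 / 20} : ℝ)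
        ≤ interactionEnergy lennardJones x) ↔
    (∃ g : ℝ, 0 < g ∧ ∀ P : PeriodicConfiguration 3,
      (∀ u ∈ P.points, ∀ v ∈ P.points, u ≠ v → (3 / 10 : ℝ) ≤ dist u v) →
      (⨅ Q : PeriodicConfiguration 3, Q.energyPerParticle lennardJones)
        + g * ((P.motif.filter fun y => ¬ IsTwoShellGoodSet (1 / 20) (47 / 50) 1 P.points y ∧
            ∃ z ∈ P.points, IsTwoShellGoodSet (1 / 20) (47 / 50) 1 P.points z ∧
              dist z y ≤ 21 / 20).card : ℝ) / (P.motif.card : ℝ)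
        ≤ P.energyPerParticle lennardJones) :=
  tightContactGap_iff_torusTightContactGap

/-- **The residual is an `e*`-free REPAIR statement**: the registered tight contact gap holds
iff one `g > 0` lets every periodic configuration with `3/10`-separated point set and a tight
contact be beaten, by some periodic configuration, by `g` per tight contact per cell.  A proof
of the residual is exactly a uniform REPAIR PROCEDURE for tight contacts in periodic matter; the
unknown `e*` has disappeared. [folklore] -/
theorem tightContactGap_iff_repair :
    (∀ δ : ℝ, 0 < δ → ∃ g₂ : ℝ, 0 < g₂ ∧ ∀ (N : ℕ) (x : Fin N → EuclideanSpace ℝ (Fin 3)),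
      (∀ i j : Fin N, i ≠ j → δ ≤ dist (x i) (x j)) →
      (N : ℝ) * (⨅ Q : PeriodicConfiguration 3, Q.energyPerParticle lennardJones)
        + g₂ * (Nat.card {j : Fin N // ¬ IsTwoShellGood (1 / 20) (47 / 50) 1 x j ∧
            ∃ i : Fin N, IsTwoShellGood (1 / 20) (47 / 50) 1 x i ∧ dist (x i) (x j) ≤ 21 / 20} : ℝ)
        ≤ interactionEnergy lennardJones x) ↔
    (∃ g : ℝ, 0 < g ∧ ∀ P : PeriodicConfiguration 3,
      (∀ u ∈ P.points, ∀ v ∈ P.points, u ≠ v → (3 / 10 : ℝ) ≤ dist u v) →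
      0 < (P.motif.filter fun y => ¬ IsTwoShellGoodSet (1 / 20) (47 / 50) 1 P.points y ∧
            ∃ z ∈ P.points, IsTwoShellGoodSet (1 / 20) (47 / 50) 1 P.points z ∧
              dist z y ≤ 21 / 20).card →
      ∃ P' : PeriodicConfiguration 3, P'.energyPerParticle lennardJones ≤
        P.energyPerParticle lennardJones
          - g * ((P.motif.filter fun y => ¬ IsTwoShellGoodSet (1 / 20) (47 / 50) 1 P.points y ∧
              ∃ z ∈ P.points, IsTwoShellGoodSet (1 / 20) (47 / 50) 1 P.points z ∧
                dist z y ≤ 21 / 20).card : ℝ) / (P.motif.card : ℝ)) :=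
  tightContactGap_iff_torusTightContactGap.trans torusTightContactGap_iff_repair

/-- **The crux in torus terms**: `NearFarGlueR ↔ (FarFieldGapR → NearFieldConvexity → torus
tight contact gap)`. [folklore] -/
theorem nearFarGlueR_iff_torusTightContactGap :
    NearFarGlueR ↔ (FarFieldGapR → NearFieldConvexity →
      ∃ g : ℝ, 0 < g ∧ ∀ P : PeriodicConfiguration 3,
        (∀ u ∈ P.points, ∀ v ∈ P.points, u ≠ v → (3 / 10 : ℝ) ≤ dist u v) →
        (⨅ Q : PeriodicConfiguration 3, Q.energyPerParticle lennardJones)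
          + g * ((P.motif.filter fun y => ¬ IsTwoShellGoodSet (1 / 20) (47 / 50) 1 P.points y ∧
              ∃ z ∈ P.points, IsTwoShellGoodSet (1 / 20) (47 / 50) 1 P.points z ∧
                dist z y ≤ 21 / 20).card : ℝ) / (P.motif.card : ℝ)
          ≤ P.energyPerParticle lennardJones) := by
  rw [nearFarGlueR_iff]
  constructor
  · intro h hF hN
    exact tightContactGap_iff_torusTightContactGap.1 (h hF hN)
  · intro h hF hN
    exact tightContactGap_iff_torusTightContactGap.2 (h hF hN)

/-- **The target in torus terms**: `CoerciveTwoShellGap ↔ AllBadGap ∧ torus tight contact gap`.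
[folklore] -/
theorem coerciveTwoShellGap_iff_allBadGap_and_torusTightContactGap :
    CoerciveTwoShellGap ↔ AllBadGap ∧
      ∃ g : ℝ, 0 < g ∧ ∀ P : PeriodicConfiguration 3,
        (∀ u ∈ P.points, ∀ v ∈ P.points, u ≠ v → (3 / 10 : ℝ) ≤ dist u v) →
        (⨅ Q : PeriodicConfiguration 3, Q.energyPerParticle lennardJones)
          + g * ((P.motif.filter fun y => ¬ IsTwoShellGoodSet (1 / 20) (47 / 50) 1 P.points y ∧
              ∃ z ∈ P.points, IsTwoShellGoodSet (1 / 20) (47 / 50) 1 P.points z ∧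
                dist z y ≤ 21 / 20).card : ℝ) / (P.motif.card : ℝ)
          ≤ P.energyPerParticle lennardJones := by
  rw [coerciveTwoShellGap_iff_allBadGap_and_tightContactGap, tightContactGap_iff_torusTightContactGap]

/-! ## §3 The explicit sufficient form: a reference configuration beating every tight contact -/

/-- **Reference gap ⇒ residual.**  If SOME periodic configuration `Q₀` (think: the optimal hcp or
fcc stacking) beats every periodic configuration with `3/10`-separated point set by `g` per tight
contact per cell — `e(Q₀) + g·#T(motif)/#motif ≤ e(P)` — then the registered residual holds
(`e* ≤ e(Q₀)`, then the torus form).  This form mentions neither `e*` nor an infimum: it is the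
quantitative crystallization inequality any imaginable proof of the residual would establish;
it is equivalent to the residual as soon as the periodic infimum is attained. [folklore] -/
theorem tightContactGap_of_referenceGap
    (h : ∃ (Q₀ : PeriodicConfiguration 3) (g : ℝ), 0 < g ∧ ∀ P : PeriodicConfiguration 3,
      (∀ u ∈ P.points, ∀ v ∈ P.points, u ≠ v → (3 / 10 : ℝ) ≤ dist u v) →
      Q₀.energyPerParticle lennardJones
        + g * ((P.motif.filter fun y => ¬ IsTwoShellGoodSet (1 / 20) (47 / 50) 1 P.points y ∧
            ∃ z ∈ P.points, IsTwoShellGoodSet (1 / 20) (47 / 50) 1 P.points z ∧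
              dist z y ≤ 21 / 20).card : ℝ) / (P.motif.card : ℝ)
        ≤ P.energyPerParticle lennardJones) :
    (∀ δ : ℝ, 0 < δ → ∃ g₂ : ℝ, 0 < g₂ ∧ ∀ (N : ℕ) (x : Fin N → EuclideanSpace ℝ (Fin 3)),
      (∀ i j : Fin N, i ≠ j → δ ≤ dist (x i) (x j)) →
      (N : ℝ) * (⨅ Q : PeriodicConfiguration 3, Q.energyPerParticle lennardJones)
        + g₂ * (Nat.card {j : Fin N // ¬ IsTwoShellGood (1 / 20) (47 / 50) 1 x j ∧
            ∃ i : Fin N, IsTwoShellGood (1 / 20) (47 / 50) 1 x i ∧ dist (x i) (x j) ≤ 21 / 20} : ℝ)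
        ≤ interactionEnergy lennardJones x) := by
  obtain ⟨Q₀, g, hg, H⟩ := h
  refine tightContactGap_iff_torusTightContactGap.2 ⟨g, hg, fun P hsep => ?_⟩
  have h0 : (⨅ Q : PeriodicConfiguration 3, Q.energyPerParticle lennardJones) ≤
      Q₀.energyPerParticle lennardJones :=
    ciInf_le ChargedEnergyGapNegative.bddBelow_energyPerParticle_lennardJones Q₀
  linarith [H P hsep]

/-! ## §4 Appendix (c5, after wave 3): the crux and the target in repair terms -/

/-- **The crux in repair terms**: `NearFarGlueR ↔ (FarFieldGapR → NearFieldConvexity → one g > 0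
lets every periodic configuration with 3/10-separated point set and a tight contact be beaten by
some periodic configuration by g per tight contact per cell)`. [folklore] -/
theorem nearFarGlueR_iff_repair :
    NearFarGlueR ↔ (FarFieldGapR → NearFieldConvexity →
      (∃ g : ℝ, 0 < g ∧ ∀ P : PeriodicConfiguration 3,
      (∀ u ∈ P.points, ∀ v ∈ P.points, u ≠ v → (3 / 10 : ℝ) ≤ dist u v) →
      0 < (P.motif.filter fun y => ¬ IsTwoShellGoodSet (1 / 20) (47 / 50) 1 P.points y ∧
            ∃ z ∈ P.points, IsTwoShellGoodSet (1 / 20) (47 / 50) 1 P.points z ∧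
              dist z y ≤ 21 / 20).card →
      ∃ P' : PeriodicConfiguration 3, P'.energyPerParticle lennardJones ≤
        P.energyPerParticle lennardJones
          - g * ((P.motif.filter fun y => ¬ IsTwoShellGoodSet (1 / 20) (47 / 50) 1 P.points y ∧
              ∃ z ∈ P.points, IsTwoShellGoodSet (1 / 20) (47 / 50) 1 P.points z ∧
                dist z y ≤ 21 / 20).card : ℝ) / (P.motif.card : ℝ))) := by
  rw [nearFarGlueR_iff]
  constructor
  · intro h hF hN
    exact tightContactGap_iff_repair.1 (h hF hN)
  · intro h hF hN
    exact tightContactGap_iff_repair.2 (h hF hN)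

/-- **The target in repair terms**: `CoerciveTwoShellGap ↔ AllBadGap ∧ (repair form)`. [folklore] -/
theorem coerciveTwoShellGap_iff_allBadGap_and_repair :
    CoerciveTwoShellGap ↔ AllBadGap ∧
      (∃ g : ℝ, 0 < g ∧ ∀ P : PeriodicConfiguration 3,
      (∀ u ∈ P.points, ∀ v ∈ P.points, u ≠ v → (3 / 10 : ℝ) ≤ dist u v) →
      0 < (P.motif.filter fun y => ¬ IsTwoShellGoodSet (1 / 20) (47 / 50) 1 P.points y ∧
            ∃ z ∈ P.points, IsTwoShellGoodSet (1 / 20) (47 / 50) 1 P.points z ∧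
              dist z y ≤ 21 / 20).card →
      ∃ P' : PeriodicConfiguration 3, P'.energyPerParticle lennardJones ≤
        P.energyPerParticle lennardJones
          - g * ((P.motif.filter fun y => ¬ IsTwoShellGoodSet (1 / 20) (47 / 50) 1 P.points y ∧
              ∃ z ∈ P.points, IsTwoShellGoodSet (1 / 20) (47 / 50) 1 P.points z ∧
                dist z y ≤ 21 / 20).card : ℝ) / (P.motif.card : ℝ)) := by
  rw [coerciveTwoShellGap_iff_allBadGap_and_tightContactGap, tightContactGap_iff_repair]

/-- **Registered sub-goal `stub_repairForm` of the line `Sketch`** (the crux in repair terms,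
route names fully qualified for the registered signature). [folklore] -/
theorem stub_repairForm :
    Summit.AtomisticToContinuum.Crystallization.Theses.PhononSlackCertificates.NearFarGlueR ↔
    (Summit.AtomisticToContinuum.Crystallization.Theses.PhononSlackCertificates.FarFieldGapR →
      Summit.AtomisticToContinuum.Crystallization.Theses.PhononSlackCertificates.NearFieldConvexity →
      (∃ g : ℝ, 0 < g ∧ ∀ P : PeriodicConfiguration 3,
      (∀ u ∈ P.points, ∀ v ∈ P.points, u ≠ v → (3 / 10 : ℝ) ≤ dist u v) →
      0 < (P.motif.filter fun y => ¬ IsTwoShellGoodSet (1 / 20) (47 / 50) 1 P.points y ∧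
            ∃ z ∈ P.points, IsTwoShellGoodSet (1 / 20) (47 / 50) 1 P.points z ∧
              dist z y ≤ 21 / 20).card →
      ∃ P' : PeriodicConfiguration 3, P'.energyPerParticle lennardJones ≤
        P.energyPerParticle lennardJones
          - g * ((P.motif.filter fun y => ¬ IsTwoShellGoodSet (1 / 20) (47 / 50) 1 P.points y ∧
              ∃ z ∈ P.points, IsTwoShellGoodSet (1 / 20) (47 / 50) 1 P.points z ∧
                dist z y ≤ 21 / 20).card : ℝ) / (P.motif.card : ℝ))) :=
  nearFarGlueR_iff_repair

/-! ## §5 Appendix: the crux and the target from the reference form -/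

/-- **Reference gap ⇒ the crux** (outright, no antecedent used): if some periodic `Q₀` beats
every periodic configuration with `3/10`-separated point set by `g` per tight contact per cell,
then `NearFarGlueR`. [folklore] -/
theorem nearFarGlueR_of_referenceGap
    (h : (∃ (Q₀ : PeriodicConfiguration 3) (g : ℝ), 0 < g ∧ ∀ P : PeriodicConfiguration 3,
      (∀ u ∈ P.points, ∀ v ∈ P.points, u ≠ v → (3 / 10 : ℝ) ≤ dist u v) →
      Q₀.energyPerParticle lennardJones
        + g * ((P.motif.filter fun y => ¬ IsTwoShellGoodSet (1 / 20) (47 / 50) 1 P.points y ∧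
            ∃ z ∈ P.points, IsTwoShellGoodSet (1 / 20) (47 / 50) 1 P.points z ∧
              dist z y ≤ 21 / 20).card : ℝ) / (P.motif.card : ℝ)
        ≤ P.energyPerParticle lennardJones)) :
    NearFarGlueR :=
  nearFarGlueR_iff.2 fun _ _ => tightContactGap_of_referenceGap h

/-- **Reference gap ∧ AllBadGap ⇒ the target.** [folklore] -/
theorem coerciveTwoShellGap_of_allBadGap_of_referenceGap (hA : AllBadGap)
    (h : (∃ (Q₀ : PeriodicConfiguration 3) (g : ℝ), 0 < g ∧ ∀ P : PeriodicConfiguration 3,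
      (∀ u ∈ P.points, ∀ v ∈ P.points, u ≠ v → (3 / 10 : ℝ) ≤ dist u v) →
      Q₀.energyPerParticle lennardJones
        + g * ((P.motif.filter fun y => ¬ IsTwoShellGoodSet (1 / 20) (47 / 50) 1 P.points y ∧
            ∃ z ∈ P.points, IsTwoShellGoodSet (1 / 20) (47 / 50) 1 P.points z ∧
              dist z y ≤ 21 / 20).card : ℝ) / (P.motif.card : ℝ)
        ≤ P.energyPerParticle lennardJones)) :
    CoerciveTwoShellGap :=
  coerciveTwoShellGap_iff_allBadGap_and_tightContactGap.2 ⟨hA, tightContactGap_of_referenceGap h⟩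

/-- **Registered sub-goal `stub_referenceForm` of the line `Sketch`**: the explicit sufficient
REFERENCE form implies the crux (route names fully qualified). [folklore] -/
theorem stub_referenceForm :
    (∃ (Q₀ : PeriodicConfiguration 3) (g : ℝ), 0 < g ∧ ∀ P : PeriodicConfiguration 3,
      (∀ u ∈ P.points, ∀ v ∈ P.points, u ≠ v → (3 / 10 : ℝ) ≤ dist u v) →
      Q₀.energyPerParticle lennardJones
        + g * ((P.motif.filter fun y => ¬ IsTwoShellGoodSet (1 / 20) (47 / 50) 1 P.points y ∧
            ∃ z ∈ P.points, IsTwoShellGoodSet (1 / 20) (47 / 50) 1 P.points z ∧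
              dist z y ≤ 21 / 20).card : ℝ) / (P.motif.card : ℝ)
        ≤ P.energyPerParticle lennardJones) →
    Summit.AtomisticToContinuum.Crystallization.Theses.PhononSlackCertificates.NearFarGlueR :=
  nearFarGlueR_of_referenceGap

end Summit.AtomisticToContinuum.Crystallization.Theorems.PhononSlackCertificatesNearFarGlueR

end
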